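import Summits.Parity.BatemanHorn.Theorems.SoloBlindNoLevel
import HarnessLib

/-!
# The tree's Ford–Maynard-normalised Type II predicate is FALSE for `n² + 1` — PROVED

Solo seat `solo-Parity-blind` (summit `Parity`, conjunct `BatemanHorn`), sequel to
`SoloBlindNoLevel.lean`.

`Literature.NumberTheory.Sieve.HasTypeIIRange A α β` asks that for all `1`-bounded coefficient
families `u_x, v_x`,
`∑_{x^α ≤ m ≤ x^β} ∑_{n ≤ x/m} u_x(m) v_x(n) (a_{mn} − X(x)/x) ≪_B X(x)/(log x)^B`;
its own docstring warns that this is the normalisation `A_d ≈ X/d` of a sequence of density `1/d`.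
The sequence of values `n² + 1` (`sqOneSeq`: `a_v = #{n ≥ 1 : n² + 1 = v}`, `X(x) = #{n ≥ 1 : n²+1 ≤ x}`,
density `ρ(m)/m`) has `ρ(3) = 0`, and this alone refutes the predicate on EVERY range
`0 ≤ α < β ≤ 1`: take `v_x ≡ 1` and `u_x` the indicator of the multiples `3k`, `⌈x^α⌉ ≤ k < 2⌈x^α⌉`
(inside `[x^α, x^β]` for large `x`); then `a_{mn} = 0` throughout (`3 ∤ ℓ² + 1`), every inner sum is
`−⌊x/m⌋ · X(x)/x ≤ −(x/(12⌈x^α⌉)) · X(x)/x`, and the double sum has absolute value `≥ X(x)/12`, which is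
not `O(X(x)/log x)`.

* `sqOneSeq_a_eq_zero_of_three_dvd` — `3 ∣ v → a_v = 0`;
* `sqOneSeq_not_hasTypeIIRange` — `0 ≤ α → α < β → β ≤ 1 → ¬ HasTypeIIRange sqOneSeq α β`.

Consequence for the programme around Bateman–Horn for `X² + 1` (the seat's "Door A": Type I at level
`x^{1/2}` plus bilinear information in `[x^{1/3}, x^{1/2}]`, Ford–Maynard 2024 Thm 2.3 with `γ = 1/2`):
the bilinear half CANNOT be stated with `HasTypeIIRange` — as a hypothesis on `sqOneSeq` it is
contradictory, so any implication from it is vacuous — and must be phrased against the comparison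
`ρ(mn) · X(x)/x` (density-normalised), which the tree does not yet have.  No `sorry`, no new axioms.

References.  K. Ford, J. Maynard, *On the theory of prime producing sieves*, arXiv:2407.14368 (2024),
§1 (Type I / Type II information, normalisation `X/d`).  G. Harman, *Prime-Detecting Sieves* (2007), §3.2.
-/

noncomputable section

open Finset Real Filter Asymptotics
open Literature.NumberTheory.Sieve

namespace Summit.Parity.BatemanHorn.Theorems.SoloBlindLevel

/-- `3` never divides `ℓ² + 1`. -/
theorem not_three_dvd_sq_add_one (ℓ : ℕ) : ¬ 3 ∣ ℓ ^ 2 + 1 := by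
  intro h
  have key : ℓ ^ 2 % 3 = (ℓ % 3) ^ 2 % 3 := Nat.pow_mod ℓ 2 3
  have hl : ℓ % 3 < 3 := Nat.mod_lt ℓ (by norm_num)
  generalize hs : ℓ ^ 2 = s at h key
  generalize hr : ℓ % 3 = r at hl key
  interval_cases r <;> norm_num at key <;> omega

/-- **`a_v = 0` whenever `3 ∣ v`:** no `n` has `n² + 1 = v`. -/
theorem sqOneSeq_a_eq_zero_of_three_dvd {v : ℕ} (hv : 3 ∣ v) : sqOneSeq.a v = 0 := by
  rw [sqOneSeq_a, Nat.cast_eq_zero, Finset.card_eq_zero, Finset.filter_eq_empty_iff]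
  intro n _ hn
  exact not_three_dvd_sq_add_one n (hn ▸ hv)

/-- Eventually `x ^ c ≥ M` for `c > 0`. -/
private theorem eventually_le_rpow {c : ℝ} (hc : 0 < c) (M : ℝ) :
    ∀ᶠ x : ℝ in atTop, M ≤ x ^ c :=
  (tendsto_rpow_atTop hc).eventually_ge_atTop M

/-- **The Ford–Maynard-normalised Type II predicate fails for `n² + 1` on every range.**
For `0 ≤ α < β ≤ 1`, `HasTypeIIRange sqOneSeq α β` is false: with `v ≡ 1` and `u` the indicator of
`{3k : ⌈x^α⌉ ≤ k < 2⌈x^α⌉}` the bilinear sum equals `−(X(x)/x) ∑_k ⌊x/(3k)⌋`, of size `≥ X(x)/12`,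
whereas the predicate (with `B = 1`) would make it `O(X(x)/log x)`. -/
theorem sqOneSeq_not_hasTypeIIRange {α β : ℝ} (hα : 0 ≤ α) (hαβ : α < β) (hβ : β ≤ 1) :
    ¬ HasTypeIIRange sqOneSeq α β := by
  intro h
  -- the witness coefficients
  set K : ℝ → ℕ := fun x => ⌈x ^ α⌉₊ with hK
  set T : ℝ → Finset ℕ := fun x => (Finset.Ico (K x) (2 * K x)).image (fun k => 3 * k) with hT
  let u : ℝ → ℕ → ℝ := fun x m => if m ∈ T x then 1 else 0
  let v : ℝ → ℕ → ℝ := fun _ _ => 1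
  have hu : ∀ x m, |u x m| ≤ 1 := by
    intro x m
    simp only [u]
    split_ifs <;> simp
  have hv : ∀ x n, |v x n| ≤ 1 := by intro x n; simp [v]
  have hO := h 1 one_pos u v hu hv
  obtain ⟨C, hC⟩ := hO.bound
  -- eventual facts about x
  have hαlt1 : α < 1 := lt_of_lt_of_le hαβ hβ
  have E0 : ∀ᶠ x : ℝ in atTop, 2 ≤ x := eventually_ge_atTop 2
  have E1 : ∀ᶠ x : ℝ in atTop, 24 ≤ x ^ (1 - α) := eventually_le_rpow (by linarith) 24
  have E2 : ∀ᶠ x : ℝ in atTop, 13 ≤ x ^ (β - α) := eventually_le_rpow (by linarith) 13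
  have E3 : ∀ᶠ x : ℝ in atTop, 12 * C + 1 ≤ Real.log x :=
    tendsto_log_atTop.eventually_ge_atTop _
  obtain ⟨x, hCx, hx2, hx1α, hxβα, hlogx⟩ := (hC.and (E0.and (E1.and (E2.and E3)))).exists
  -- basic positivity
  have hx0 : 0 < x := by linarith
  have hx1 : 1 ≤ x := by linarith
  have hxα1 : 1 ≤ x ^ α := one_le_rpow hx1 hα
  have hxα0 : 0 ≤ x ^ α := by linarith
  have hKpos : 0 < K x := Nat.ceil_pos.mpr (by linarith)
  have hKlt : (K x : ℝ) < x ^ α + 1 := Nat.ceil_lt_add_one hxα0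
  have hKge : x ^ α ≤ (K x : ℝ) := Nat.le_ceil _
  -- 12 K ≤ x
  have h12K : 12 * (K x : ℝ) ≤ x := by
    have hprod : x ^ α * x ^ (1 - α) = x := by
      rw [← rpow_add hx0]; norm_num
    have : 24 * x ^ α ≤ x :=
      calc 24 * x ^ α ≤ x ^ α * x ^ (1 - α) := by
            nlinarith [mul_le_mul_of_nonneg_left hx1α hxα0]
        _ = x := hprod
    linarith
  -- 6 K ≤ ⌊x^β⌋ (so T x sits inside the range)
  have h6K : 6 * K x ≤ ⌊x ^ β⌋₊ := by
    have hsplit : x ^ β = x ^ α * x ^ (β - α) := by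
      rw [← rpow_add hx0]; congr 1; ring
    have h13 : 13 * x ^ α ≤ x ^ β := by
      rw [hsplit]
      have := mul_le_mul_of_nonneg_left hxβα hxα0
      linarith
    have hreal : (6 * K x : ℝ) ≤ x ^ β - 1 := by linarith
    have hfl : x ^ β < (⌊x ^ β⌋₊ : ℝ) + 1 := Nat.lt_floor_add_one _
    have : ((6 * K x : ℕ) : ℝ) < (⌊x ^ β⌋₊ : ℝ) + 1 := by push_cast; linarith
    have : 6 * K x < ⌊x ^ β⌋₊ + 1 := by exact_mod_cast this
    omega
  have hTsub : T x ⊆ Finset.Icc ⌈x ^ α⌉₊ ⌊x ^ β⌋₊ := by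
    intro m hm
    simp only [hT, Finset.mem_image, Finset.mem_Ico] at hm
    obtain ⟨k, ⟨hk1, hk2⟩, rfl⟩ := hm
    rw [Finset.mem_Icc]
    constructor
    · change K x ≤ 3 * k
      omega
    · omega
  -- evaluate the double sum at this x
  set S : ℝ := sqOneSeq.size x with hS
  have hS1 : 1 ≤ S := by
    rw [hS, sqOneSeq_size]; exact_mod_cast one_le_sqCount hx2
  have hS0 : 0 < S := by linarith
  have hinner : ∀ m ∈ T x,
      ∑ n ∈ Finset.Icc 1 ⌊x / m⌋₊, u x m * v x n * (sqOneSeq.a (m * n) - S / x)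
        = -(S / x) * (⌊x / m⌋₊ : ℝ) := by
    intro m hm
    have h3 : 3 ∣ m := by
      simp only [hT, Finset.mem_image] at hm
      obtain ⟨k, -, rfl⟩ := hm
      exact dvd_mul_right 3 k
    have hum : u x m = 1 := by simp [u, hm]
    have hterm : ∀ n ∈ Finset.Icc 1 ⌊x / m⌋₊,
        u x m * v x n * (sqOneSeq.a (m * n) - S / x) = -(S / x) := by
      intro n _
      rw [hum, sqOneSeq_a_eq_zero_of_three_dvd (dvd_mul_of_dvd_left h3 n)]
      simp [v]
    rw [Finset.sum_congr rfl hterm, Finset.sum_const, Nat.card_Icc, Nat.add_sub_cancel, nsmul_eq_mul]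
    ring
  have hF : (∑ m ∈ Finset.Icc ⌈x ^ α⌉₊ ⌊x ^ β⌋₊, ∑ n ∈ Finset.Icc 1 ⌊x / m⌋₊,
        u x m * v x n * (sqOneSeq.a (m * n) - S / x))
      = -(S / x) * ∑ k ∈ Finset.Ico (K x) (2 * K x), (⌊x / ((3 * k : ℕ) : ℝ)⌋₊ : ℝ) := by
    have hzero : ∀ m ∈ Finset.Icc ⌈x ^ α⌉₊ ⌊x ^ β⌋₊, m ∉ T x →
        ∑ n ∈ Finset.Icc 1 ⌊x / m⌋₊, u x m * v x n * (sqOneSeq.a (m * n) - S / x) = 0 := by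
      intro m _ hm
      have hum : u x m = 0 := by simp [u, hm]
      simp [hum]
    rw [← Finset.sum_subset hTsub hzero, Finset.sum_congr rfl hinner, ← Finset.mul_sum, hT,
      Finset.sum_image]
    intro a _ b _ hab
    exact Nat.eq_of_mul_eq_mul_left (by norm_num) hab
  -- lower bound for the k-sum: each term ≥ x/(12K), K terms
  have hterm_lb : ∀ k ∈ Finset.Ico (K x) (2 * K x),
      x / (12 * (K x : ℝ)) ≤ (⌊x / ((3 * k : ℕ) : ℝ)⌋₊ : ℝ) := by
    intro k hk
    rw [Finset.mem_Ico] at hk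
    obtain ⟨hk1, hk2⟩ := hk
    have hkpos : (0 : ℝ) < k := by exact_mod_cast lt_of_lt_of_le hKpos hk1
    have hk6 : ((3 * k : ℕ) : ℝ) ≤ 6 * (K x : ℝ) := by
      push_cast
      have : (k : ℝ) ≤ 2 * (K x : ℝ) := by exact_mod_cast hk2.le
      linarith
    have h3kpos : (0 : ℝ) < ((3 * k : ℕ) : ℝ) := by push_cast; linarith
    have hKr : (0 : ℝ) < (K x : ℝ) := by exact_mod_cast hKpos
    -- x/(3k) ≥ x/(6K) ≥ 2
    have hge : x / (6 * (K x : ℝ)) ≤ x / ((3 * k : ℕ) : ℝ) :=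
      div_le_div_of_nonneg_left hx0.le h3kpos hk6
    have hge2 : 2 ≤ x / (6 * (K x : ℝ)) := by
      rw [le_div_iff₀ (by positivity)]; linarith
    have hfl : x / ((3 * k : ℕ) : ℝ) - 1 < (⌊x / ((3 * k : ℕ) : ℝ)⌋₊ : ℝ) := by
      have := Nat.lt_floor_add_one (x / ((3 * k : ℕ) : ℝ))
      linarith
    have hhalf : x / (12 * (K x : ℝ)) = x / (6 * (K x : ℝ)) / 2 := by
      rw [show (12 : ℝ) * (K x : ℝ) = 6 * (K x : ℝ) * 2 by ring, ← div_div]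
    rw [hhalf]
    linarith
  have hsum_lb : x / 12 ≤ ∑ k ∈ Finset.Ico (K x) (2 * K x), (⌊x / ((3 * k : ℕ) : ℝ)⌋₊ : ℝ) := by
    have hcard : (Finset.Ico (K x) (2 * K x)).card = K x := by
      rw [Nat.card_Ico]; omega
    have := Finset.card_nsmul_le_sum _ _ _ hterm_lb
    rw [hcard, nsmul_eq_mul] at this
    have hKr : (0 : ℝ) < (K x : ℝ) := by exact_mod_cast hKpos
    calc x / 12 = (K x : ℝ) * (x / (12 * (K x : ℝ))) := by
          rw [← mul_div_assoc, mul_comm (K x : ℝ) x, mul_div_mul_right x 12 hKr.ne']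
      _ ≤ _ := this
  -- hence ‖F x‖ ≥ S/12
  have hSx : 0 ≤ S / x := by positivity
  have hsum_nn : 0 ≤ ∑ k ∈ Finset.Ico (K x) (2 * K x), (⌊x / ((3 * k : ℕ) : ℝ)⌋₊ : ℝ) :=
    Finset.sum_nonneg fun k _ => Nat.cast_nonneg _
  have hnormF : S / 12 ≤ ‖∑ m ∈ Finset.Icc ⌈x ^ α⌉₊ ⌊x ^ β⌋₊, ∑ n ∈ Finset.Icc 1 ⌊x / m⌋₊,
        u x m * v x n * (sqOneSeq.a (m * n) - S / x)‖ := by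
    rw [hF, norm_mul, norm_neg, Real.norm_of_nonneg hSx, Real.norm_of_nonneg hsum_nn]
    calc S / 12 = S / x * (x / 12) := by
          rw [div_mul_div_comm, mul_comm x 12, mul_div_mul_right _ _ hx0.ne']
      _ ≤ S / x * _ := mul_le_mul_of_nonneg_left hsum_lb hSx
  -- and the claimed bound says ‖F x‖ ≤ C · S/log x
  have hlogpos : 0 < Real.log x := Real.log_pos (by linarith)
  have hG : ‖S / Real.log x ^ (1 : ℝ)‖ = S / Real.log x := by
    rw [Real.rpow_one, Real.norm_of_nonneg (div_nonneg hS0.le hlogpos.le)]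
  have hle : S / 12 ≤ C * (S / Real.log x) := by
    have := hnormF.trans hCx
    rwa [hG] at this
  -- so log x ≤ 12 C, contradicting log x ≥ 12 C + 1
  have key : S * (1 / 12) ≤ S * (C / Real.log x) :=
    calc S * (1 / 12) = S / 12 := by ring
      _ ≤ C * (S / Real.log x) := hle
      _ = S * (C / Real.log x) := by ring
  have key2 : 1 / 12 ≤ C / Real.log x := le_of_mul_le_mul_left key hS0
  rw [le_div_iff₀ hlogpos] at key2
  linarith

end Summit.Parity.BatemanHorn.Theorems.SoloBlindLevel

end

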